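import Literature.NumberTheory.Sieve.FordMaynardSieveBoundG1
import HarnessLib

/-!
# Route `FordMaynardSieveConst01651`, target `SieveConst01651` (stmt-Parity-19185), stub `stub_coneCertClosed`,
# conjunct (iv): the certifier's FACE-PENALTY device

Def-free helper file.  The certified table (`…SieveConst01651CertTable`) defines `g` on OPEN cells / pieces; the
certifier (parity-ideate-p3, fm27_cert_lp.py) extends it to the measure-zero cell faces and band lines by the value `−M`,
`M ≥ 2^k·max|g|`, so that the sign clause `(𝟙⋆g)(x) ≤ 0` holds TRIVIALLY at every point of `ℋ_k` having a subvector on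
a face, and only GENERIC points (every subvector in an open piece) need the type check.  This file is that device,
for an arbitrary decomposition `g₀ = gTab + gFace`:

* `starSum_add'` — `(𝟙⋆(g+h)) = (𝟙⋆g) + (𝟙⋆h)`;
* `starSum_le_pow_mul` — `g ≤ B` on all subvectors ⇒ `(𝟙⋆g)(x) ≤ 2^k · B`;
* `starSum_le_of_face` — `h ≤ 0` on all subvectors and `h(x_{A₀}) ≤ −M` for one `A₀` ⇒ `(𝟙⋆h)(x) ≤ −M`;
* `starSum_nonpos_of_face` — the device: `gTab ≤ B`, `gFace ≤ 0`, one face subvector with `gFace ≤ −M`, `2^k·B ≤ M`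
  ⇒ `(𝟙⋆(gTab + gFace))(x) ≤ 0`;
* `starSum_eq_of_generic` — if `gFace` vanishes on every subvector of `x` then `(𝟙⋆(gTab + gFace))(x) = (𝟙⋆gTab)(x)`.

With `…SignClauseByDim` (k = 2, 3, 6 from table facts) this leaves, for conjunct (iv), exactly: `(𝟙⋆gTab)(x) ≤ 0` for
GENERIC monotone `x ∈ ℋ_k`, `k = 4, 5` — the certifier's (H1) on 55 225 + 86 966 open types.

References: K. Ford, J. Maynard, arXiv:2407.14368, Definitions 7.1–7.2 (𝒮𝒢₁ allows any bounded values on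
lower-dimensional polytopes), Theorem 7.3 (a). [FordMaynard2024PrimeSieves]
-/

noncomputable section

open Finset
open scoped Classical
open Literature.NumberTheory.Sieve Literature.NumberTheory.Sieve.FordMaynard

namespace Summit.Parity.GeneralizedHardyLittlewood.FordMaynardSieveConst01651SieveConst01651

/-- `(𝟙⋆(g + h))(x) = (𝟙⋆g)(x) + (𝟙⋆h)(x)`. [cite: FordMaynard2024PrimeSieves, Definition 7.1] -/
theorem starSum_add' (g h : VecFn) (k : ℕ) (x : Fin k → ℝ) :
    starSum (fun r y => g r y + h r y) k x = starSum g k x + starSum h k x := by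
  unfold starSum
  rw [← Finset.sum_add_distrib]

/-- If `g ≤ B` on every subvector of `x` then `(𝟙⋆g)(x) ≤ 2^k · B`. [cite: FordMaynard2024PrimeSieves, Definition 7.1] -/
theorem starSum_le_pow_mul (g : VecFn) {k : ℕ} (x : Fin k → ℝ) {B : ℝ}
    (hB : ∀ A : Finset (Fin k), g A.card (fun i => x (A.orderEmbOfFin rfl i)) ≤ B) :
    starSum g k x ≤ 2 ^ k * B := by
  unfold starSum
  calc ∑ A : Finset (Fin k), g A.card (fun i => x (A.orderEmbOfFin rfl i))
      ≤ ∑ _A : Finset (Fin k), B := Finset.sum_le_sum fun A _ => hB A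
    _ = 2 ^ k * B := by
        rw [Finset.sum_const, Finset.card_univ, Fintype.card_finset, Fintype.card_fin, nsmul_eq_mul]
        push_cast; ring

/-- If `h ≤ 0` on every subvector of `x` and `h(x_{A₀}) ≤ −M` for one subvector, then `(𝟙⋆h)(x) ≤ −M`.
[cite: FordMaynard2024PrimeSieves, Definition 7.1] -/
theorem starSum_le_of_face (h : VecFn) {k : ℕ} (x : Fin k → ℝ) {M : ℝ}
    (hle : ∀ A : Finset (Fin k), h A.card (fun i => x (A.orderEmbOfFin rfl i)) ≤ 0)
    (A₀ : Finset (Fin k)) (hA₀ : h A₀.card (fun i => x (A₀.orderEmbOfFin rfl i)) ≤ -M) :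
    starSum h k x ≤ -M := by
  unfold starSum
  rw [← Finset.add_sum_erase Finset.univ _ (Finset.mem_univ A₀)]
  have hrest : ∑ A ∈ Finset.univ.erase A₀, h A.card (fun i => x (A.orderEmbOfFin rfl i)) ≤ 0 :=
    Finset.sum_nonpos fun A _ => hle A
  linarith

/-- **The face-penalty device.** Let `g₀ = gTab + gFace` with `gTab ≤ B` and `gFace ≤ 0` on every subvector of `x`,
and suppose some subvector `x_{A₀}` lies on a face, `gFace(x_{A₀}) ≤ −M`, where `2^k · B ≤ M`.  Then
`(𝟙⋆g₀)(x) ≤ 0` — boundary points of `ℋ_k` never need the type check.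
[cite: FordMaynard2024PrimeSieves, Definition 7.2 and Theorem 7.3 (a)] -/
theorem starSum_nonpos_of_face (gTab gFace : VecFn) {k : ℕ} (x : Fin k → ℝ) {B M : ℝ}
    (hB : ∀ A : Finset (Fin k), gTab A.card (fun i => x (A.orderEmbOfFin rfl i)) ≤ B)
    (hle : ∀ A : Finset (Fin k), gFace A.card (fun i => x (A.orderEmbOfFin rfl i)) ≤ 0)
    (A₀ : Finset (Fin k)) (hA₀ : gFace A₀.card (fun i => x (A₀.orderEmbOfFin rfl i)) ≤ -M)
    (hBM : 2 ^ k * B ≤ M) :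
    starSum (fun r y => gTab r y + gFace r y) k x ≤ 0 := by
  rw [starSum_add']
  have h1 := starSum_le_pow_mul gTab x hB
  have h2 := starSum_le_of_face gFace x hle A₀ hA₀
  linarith

/-- **Generic points see only the table part.** If `gFace` vanishes on every subvector of `x` then
`(𝟙⋆(gTab + gFace))(x) = (𝟙⋆gTab)(x)`. [cite: FordMaynard2024PrimeSieves, Definition 7.1] -/
theorem starSum_eq_of_generic (gTab gFace : VecFn) {k : ℕ} (x : Fin k → ℝ)
    (hzero : ∀ A : Finset (Fin k), gFace A.card (fun i => x (A.orderEmbOfFin rfl i)) = 0) :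
    starSum (fun r y => gTab r y + gFace r y) k x = starSum gTab k x := by
  rw [starSum_add']
  have : starSum gFace k x = 0 := by
    unfold starSum
    exact Finset.sum_eq_zero fun A _ => hzero A
  rw [this, add_zero]

/-- The sign clause for a sum `gTab + gFace` at a point: EITHER some subvector is a face point (then the device) OR
all face values vanish (then the table check `(𝟙⋆gTab)(x) ≤ 0`).  This is the exact shape in which the certifier's
(H1) — a statement about `gTab` on generic points only — discharges conjunct (iv).
[cite: FordMaynard2024PrimeSieves, Theorem 7.3 (a)] -/
theorem starSum_nonpos_of_face_or_generic (gTab gFace : VecFn) {k : ℕ} (x : Fin k → ℝ) {B M : ℝ}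
    (hB : ∀ A : Finset (Fin k), gTab A.card (fun i => x (A.orderEmbOfFin rfl i)) ≤ B)
    (hle : ∀ A : Finset (Fin k), gFace A.card (fun i => x (A.orderEmbOfFin rfl i)) ≤ 0)
    (hface : ∀ A : Finset (Fin k), gFace A.card (fun i => x (A.orderEmbOfFin rfl i)) ≠ 0 →
      gFace A.card (fun i => x (A.orderEmbOfFin rfl i)) ≤ -M)
    (hBM : 2 ^ k * B ≤ M)
    (htab : (∀ A : Finset (Fin k), gFace A.card (fun i => x (A.orderEmbOfFin rfl i)) = 0) → starSum gTab k x ≤ 0) :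
    starSum (fun r y => gTab r y + gFace r y) k x ≤ 0 := by
  by_cases hgen : ∀ A : Finset (Fin k), gFace A.card (fun i => x (A.orderEmbOfFin rfl i)) = 0
  · rw [starSum_eq_of_generic gTab gFace x hgen]; exact htab hgen
  · push Not at hgen
    obtain ⟨A₀, hA₀⟩ := hgen
    exact starSum_nonpos_of_face gTab gFace x hB hle A₀ (hface A₀ hA₀) hBM

end Summit.Parity.GeneralizedHardyLittlewood.FordMaynardSieveConst01651SieveConst01651

end
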